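import Mathlib
import Summits.ValiantsHypothesis.ValiantsHypothesis.Theorems.StableRankCancellationEscalationCore
import Literature.Computability.AlgebraicComplexity.ArithCircuitProofs
import HarnessLib

/-!
# Route StableRankCancellation — escalation (item stmt-ValiantsHypothesis-10613)

`Escalation`: `MinCutStableRankBound → DesignFlat →` the bundled Reed–Solomon design family
`m ↦ NW_{q,d,k}` (`q = m+1`, `d = ⌊log₂ q⌋`, `k = ⌊d/2⌋`) is not in `VP ℂ`.

Proof. By the core reduction (`escalation_core`, sibling file): for every prime `q ≥ 4` and every
fan-in-two circuit `P` computing `NW`, `q^{⌊d/3⌋} ≤ (|P| + q)^C (d+2)^{Cd}`. If the family were in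
`VP ℂ`, then (`mem_VP_ofFintype_iff_holds`, `IsPComputable`, `exists_computes_size_eq_complexity`)
`|P| ≤ m^c + c` for an optimal circuit; but for `d` large (a prime `q ≥ 2^{D₀}` exists,
`Nat.exists_infinite_primes`) the right-hand side is `2^{O(d log d)}` while the left-hand side is
`2^{Ω(d²)}` (`asymptotic_bound`: `(s + q)^C (d+2)^{Cd} < q^{⌊d/3⌋}` whenever `s ≤ q^c + c`,
`2^d ≤ q < 2^{d+1}`, `d ≥ D₀(C,c)`; the only analysis used is `L(u+1)+2 ≤ 2^u` for `u ≥ 3L`).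

* `escalation_proof : Escalation` — the item, verbatim.

Honest framing: bookkeeping over OPEN cruxes (`MinCutStableRankBound` is conjectural); nothing
here is progress on VP ≠ VNP.

## References

* N. Kayal, C. Saha, R. Saptharishi, STOC 2014 (the design polynomial as a lower-bound witness).
  [cite: KayalSahaSaptharishi2014, §1]
* P. Bürgisser, *Completeness and Reduction in Algebraic Complexity Theory* (2000), Def. 2.4
  (`VP`). [cite: Burgisser2000, Def. 2.4]
-/

set_option linter.dupNamespace false

noncomputable section

open Finset MvPolynomial

namespace Summit.ValiantsHypothesis.ValiantsHypothesis.Theorems.StableRankCancellationEscalation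

open Literature.Computability.AlgebraicComplexity

/-! ### Elementary growth lemmas -/

/-- `L (u+1) + 2 ≤ 2^u` for `u ≥ 3L` (`L ≥ 1`). [folklore] -/
theorem lin_le_two_pow {L : ℕ} (hL : 1 ≤ L) {u : ℕ} (hu : 3 * L ≤ u) :
    L * (u + 1) + 2 ≤ 2 ^ u := by
  induction u, hu using Nat.le_induction with
  | base =>
    have h1 : L + 1 ≤ 2 ^ L := Nat.lt_two_pow_self
    have h3 : 1 ≤ L ^ 3 := Nat.one_le_pow _ _ hL
    calc L * (3 * L + 1) + 2 ≤ (L + 1) ^ 3 := by nlinarith [h3]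
      _ ≤ (2 ^ L) ^ 3 := Nat.pow_le_pow_left h1 3
      _ = 2 ^ (3 * L) := by rw [← pow_mul, mul_comm]
  | succ u hu ih =>
    rw [pow_succ]
    nlinarith

/-- `d + 2 ≤ 2^{⌊d/L⌋}` for `d ≥ 3L²` (`L ≥ 1`). [folklore] -/
theorem add_two_le_two_pow_div {L : ℕ} (hL : 1 ≤ L) {d : ℕ} (hd : 3 * L * L ≤ d) :
    d + 2 ≤ 2 ^ (d / L) := by
  have hu : 3 * L ≤ d / L := (Nat.le_div_iff_mul_le hL).2 (by nlinarith)
  have h := lin_le_two_pow hL hu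
  have hlt : d < L * (d / L + 1) := by
    have := Nat.lt_mul_div_succ d hL
    linarith [Nat.mul_comm L (d / L + 1)]
  omega

/-- **The asymptotic step**: for `d ≥ D₀(C,c)`, `2^d ≤ q < 2^{d+1}` and `s ≤ q^c + c`,
`(s + q)^C (d+2)^{Cd} < q^{⌊d/3⌋}`. [folklore] -/
theorem asymptotic_bound (C c : ℕ) : ∃ D₀ : ℕ, ∀ d, D₀ ≤ d → ∀ q s : ℕ, 2 ≤ q → 2 ^ d ≤ q →
    q < 2 ^ (d + 1) → s ≤ q ^ c + c → (s + q) ^ C * (d + 2) ^ (C * d) < q ^ (d / 3) := by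
  set L := 6 * (C + 1) with hL
  have hL1 : 1 ≤ L := by omega
  refine ⟨3 * L * L + 6 * (2 * C * (c + 2) + 2), fun d hd q s hq2 hqd hqd1 hs => ?_⟩
  have hd1 : 1 ≤ d := by nlinarith
  -- (1) `(d+2)^{Cd} ≤ 2^{(d/6)·d}`
  have hB : (d + 2) ^ (C * d) ≤ 2 ^ (d / 6 * d) := by
    have h1 : d + 2 ≤ 2 ^ (d / L) := add_two_le_two_pow_div hL1 (by omega)
    have h2 : d / L * C ≤ d / 6 := by
      rw [Nat.le_div_iff_mul_le (by norm_num)]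
      have h3 : d / L * L ≤ d := Nat.div_mul_le_self d L
      calc d / L * C * 6 ≤ d / L * (C + 1) * 6 := by gcongr; omega
        _ = d / L * L := by rw [hL]; ring
        _ ≤ d := h3
    calc (d + 2) ^ (C * d) ≤ (2 ^ (d / L)) ^ (C * d) := Nat.pow_le_pow_left h1 _
      _ = 2 ^ (d / L * C * d) := by rw [← pow_mul]; ring_nf
      _ ≤ 2 ^ (d / 6 * d) := Nat.pow_le_pow_right (by norm_num) (Nat.mul_le_mul_right d h2)
  -- (2) `(s + q)^C ≤ 2^{C((d+1)(c+1)+2)}`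
  have hq1 : 1 ≤ q := by omega
  have hA : (s + q) ^ C ≤ 2 ^ (C * ((d + 1) * (c + 1) + 2)) := by
    have hqc : c ≤ q ^ c := (Nat.lt_two_pow_self).le.trans (Nat.pow_le_pow_left hq2 c)
    have hqc' : q ^ c ≤ q ^ (c + 1) := Nat.pow_le_pow_right hq1 (by omega)
    have hqq : q ≤ q ^ (c + 1) := by
      calc q = q ^ 1 := (pow_one q).symm
        _ ≤ q ^ (c + 1) := Nat.pow_le_pow_right hq1 (by omega)
    have hsum : s + q ≤ 4 * q ^ (c + 1) := by omega
    have hpow : q ^ (c + 1) ≤ 2 ^ ((d + 1) * (c + 1)) := by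
      rw [pow_mul]; exact Nat.pow_le_pow_left hqd1.le _
    calc (s + q) ^ C ≤ (4 * q ^ (c + 1)) ^ C := Nat.pow_le_pow_left hsum C
      _ ≤ (2 ^ 2 * 2 ^ ((d + 1) * (c + 1))) ^ C := by
          refine Nat.pow_le_pow_left ?_ C
          exact Nat.mul_le_mul (by norm_num) hpow
      _ = 2 ^ (C * ((d + 1) * (c + 1) + 2)) := by rw [← pow_add, ← pow_mul]; ring_nf
  -- (3) exponents
  set k := d / 6 with hk
  have hk2 : 2 * C * (c + 2) + 2 ≤ k := by
    rw [hk, Nat.le_div_iff_mul_le (by norm_num)]; omega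
  have hk3 : 2 * k ≤ d / 3 := by omega
  have hexp : C * ((d + 1) * (c + 1) + 2) + k * d < d * (d / 3) := by
    have h1 : C * ((d + 1) * (c + 1) + 2) < k * d := by nlinarith
    have h2 : k * d + k * d ≤ d * (d / 3) := by nlinarith
    omega
  -- (4) assemble
  calc (s + q) ^ C * (d + 2) ^ (C * d)
      ≤ 2 ^ (C * ((d + 1) * (c + 1) + 2)) * 2 ^ (k * d) := Nat.mul_le_mul hA hB
    _ = 2 ^ (C * ((d + 1) * (c + 1) + 2) + k * d) := by rw [← pow_add]
    _ < 2 ^ (d * (d / 3)) := Nat.pow_lt_pow_right (by norm_num) hexp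
    _ = (2 ^ d) ^ (d / 3) := by rw [← pow_mul]
    _ ≤ q ^ (d / 3) := Nat.pow_le_pow_left hqd _

/-! ### The item -/

/-- **Route StableRankCancellation, item `Escalation` (stmt-ValiantsHypothesis-10613)**:
`MinCutStableRankBound → DesignFlat →` the design family is not in `VP ℂ`.
[cite: KayalSahaSaptharishi2014, §1] [cite: Burgisser2000, Def. 2.4] -/
theorem escalation_proof : Theses.StableRankCancellation.Escalation := by
  intro hX hDF hVP
  classical
  obtain ⟨C, hcore⟩ := escalation_core hX hDF
  -- unpack `VP` membership: polynomially bounded circuit complexity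
  have hfam := (mem_VP_ofFintype_iff_holds _).1 hVP
  obtain ⟨c, hc⟩ := hfam.2
  obtain ⟨D₀, hD⟩ := asymptotic_bound C c
  -- a large prime `q`
  obtain ⟨q, hqge, hqprime⟩ := Nat.exists_infinite_primes (2 ^ max D₀ 2)
  have hq2 : 2 ≤ q := hqprime.two_le
  have hq1 : q - 1 + 1 = q := by omega
  have hprime' : (q - 1 + 1).Prime := by rw [hq1]; exact hqprime
  have hd : max D₀ 2 ≤ Nat.log 2 (q - 1 + 1) := by
    rw [hq1, Nat.le_log_iff_pow_le (by norm_num) (by omega)]; exact hqge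
  have h4 : 4 ≤ q - 1 + 1 := by
    rw [hq1]
    calc 4 = 2 ^ 2 := by norm_num
      _ ≤ 2 ^ max D₀ 2 := Nat.pow_le_pow_right (by norm_num) (le_max_right _ _)
      _ ≤ q := hqge
  -- an optimal circuit for `NW_{q}`
  obtain ⟨P, hP2, hPc, hsize⟩ := ArithCircuit.exists_computes_size_eq_complexity
    (∑ cf : Fin (Nat.log 2 (q - 1 + 1) / 2) → ZMod (q - 1 + 1), ∏ j : Fin (Nat.log 2 (q - 1 + 1)),
      (X (⟨j, ∑ i : Fin (Nat.log 2 (q - 1 + 1) / 2), cf i * ((j : ℕ) : ZMod (q - 1 + 1)) ^ (i : ℕ)⟩ :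
        Σ _ : Fin (Nat.log 2 (q - 1 + 1)), ZMod (q - 1 + 1)) :
        MvPolynomial (Σ _ : Fin (Nat.log 2 (q - 1 + 1)), ZMod (q - 1 + 1)) ℂ))
  have h1 := hcore (q - 1) hprime' h4 P hP2 hPc
  have hs : P.size ≤ (q - 1 + 1) ^ c + c := by
    rw [hsize]
    refine (hc (q - 1)).trans ?_
    gcongr
    omega
  have h2 := hD (Nat.log 2 (q - 1 + 1)) ((le_max_left _ _).trans hd) (q - 1 + 1) P.size
    (by omega) (Nat.pow_log_le_self 2 (by omega)) (Nat.lt_pow_succ_log_self (by norm_num) _) hs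
  exact absurd h1 (not_le.2 h2)

end Summit.ValiantsHypothesis.ValiantsHypothesis.Theorems.StableRankCancellationEscalation

end
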